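import Summits.ResolutionOfSingularities.ResolutionOfSingularities.Theorems.WeightedInvariantHypersurfaceCentreAlgebraize
import Literature.RingTheory.GradedAlgebra.VeroneseOfFiltration
import Mathlib.RingTheory.Nakayama
import HarnessLib

/-!
# Comparing the weighted filtrations of two systems of parameters (Nakayama form; the height-two criterion)

Route `ResolutionOfSingularities/WeightedInvariant`, door crux `HypersurfaceCentreConstruction`
(stmt-ResolutionOfSingularities-19897) — OURS, helper; e-ladder `e = 1`, registered stub `stub_e1_centre` of
`res-L1-w43-stub-10` (cell res-hironaka, `D/res-D-pv-025/DOOR-ELADDER-PLAN.md` §7–§8: sub-lemma **L0-charts** —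
re-choosing HOMOGENEOUS chart parameters along the orbit closure — and **L3** — invariance of the germ filtration).
Both steps replace the Abramovich–Quek–Schober germ parameters `x = (x₀, x₁)` by other parameters `f` and must know
that the weighted filtrations `𝒥ₙ(x; w) = (x^α : w·α ≥ n)` (`weightedMonomialIdeal`) and `𝒥ₙ(f; w)` AGREE.  The
one-sided valuative criterion `fᵢ ∈ 𝒥_{wᵢ}(x) ⇒ 𝒥ₙ(f) ⊆ 𝒥ₙ(x)` is the tree's jets lemma
`weightedMonomialIdeal_le_of_forall_mem` (file `…HypersurfaceCentreAlgebraize`); here: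

* `weightedMonomialIdeal_le_of_forall_mem_of_mul_le` — the jets lemma against an arbitrary multiplicative antitone
  family of ideals (`Literature.RingTheory.GradedAlgebra.prod_pow_mem_of_mul_le`);
* `weightedMonomialIdeal_le_sup_mul_of_forall_mem_sup`, `weightedMonomialIdeal_eq_of_forall_mem_sup` — **Nakayama
  form**: `fᵢ ∈ 𝒥_{wᵢ}(x)` and `xᵢ ∈ 𝒥_{wᵢ}(f) + 𝔪·𝒥_{wᵢ}(x)` for all `i` (Noetherian, `𝔪` in the Jacobson radical)
  imply `𝒥ₙ(f) = 𝒥ₙ(x)` for all `n`;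
* **`weightedMonomialIdeal_eq_of_height_two`** — the criterion actually used along an orbit closure: in a local ring,
  for TWO parameters with weights `w₁ ≤ w₀`, if `x` and `f` both generate `𝔪`, `f₀ ∈ 𝒥_{w₀}(x)` and `f₀ ∉ 𝔪²`, then
  `𝒥ₙ(f; w) = 𝒥ₙ(x; w)` for all `n` (write `f₀ = a x₀ + r`, `r ∈ (x₁^e : e w₁ ≥ w₀)`; if `w₀ > w₁` then `r ∈ 𝔪²`, so
  `a` is a unit and `x₀ ∈ (f₀) + 𝒥_{w₀}(f)`).

Pure commutative algebra, no named facts. AI-written; weaker than expert review.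
-/

noncomputable section

set_option linter.dupNamespace false -- mandated namespace of this single-conjunct summit

namespace Summit.ResolutionOfSingularities.ResolutionOfSingularities.Theorems

universe u

open Literature.AlgebraicGeometry.Resolution

variable {A : Type u} [CommRing A]

/-! ## The jets lemma against a multiplicative family -/

/-- If `gᵢ ∈ P_{wᵢ}` for all `i`, for a multiplicative antitone family of ideals `P` (`P₀ = A`,
`P_a P_b ⊆ P_{a+b}`), then `𝒥ₙ(g; w) ⊆ Pₙ` for all `n`. [folklore] -/
theorem weightedMonomialIdeal_le_of_forall_mem_of_mul_le (P : ℕ → Ideal A) (h0 : P 0 = ⊤)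
    (hmul : ∀ a b, P a * P b ≤ P (a + b)) (hanti : Antitone P) {m : ℕ} (g : Fin m → A) (w : Fin m → ℕ)
    (hg : ∀ i, g i ∈ P (w i)) (n : ℕ) : weightedMonomialIdeal g w n ≤ P n := by
  rw [weightedMonomialIdeal, Ideal.span_le]
  rintro _ ⟨α, hα, rfl⟩
  have h := Literature.RingTheory.GradedAlgebra.prod_pow_mem_of_mul_le h0 hmul hg Finset.univ α
  have hsum : ∑ i, α i * w i = ∑ i, w i * α i := Finset.sum_congr rfl fun i _ => mul_comm _ _
  rw [hsum] at h
  exact hanti hα h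

/-! ## The Nakayama form -/

variable {m : ℕ} (x f : Fin m → A) (w : Fin m → ℕ)

/-- The family `𝒥ₐ(f) + 𝔪·𝒥ₐ(x)` is multiplicative when `fᵢ ∈ 𝒥_{wᵢ}(x)` for all `i`. [folklore] -/
theorem sup_mul_weightedMonomialIdeal_mul_le (𝔪 : Ideal A) (hf : ∀ i, f i ∈ weightedMonomialIdeal x w (w i))
    (a b : ℕ) :
    (weightedMonomialIdeal f w a ⊔ 𝔪 * weightedMonomialIdeal x w a) *
        (weightedMonomialIdeal f w b ⊔ 𝔪 * weightedMonomialIdeal x w b) ≤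
      weightedMonomialIdeal f w (a + b) ⊔ 𝔪 * weightedMonomialIdeal x w (a + b) := by
  have hfa := weightedMonomialIdeal_le_of_forall_mem x f w hf a
  have hfb := weightedMonomialIdeal_le_of_forall_mem x f w hf b
  have hxx := weightedMonomialIdeal_mul_le x w a b
  have hff := weightedMonomialIdeal_mul_le f w a b
  rw [Ideal.sup_mul, Ideal.mul_sup, Ideal.mul_sup]
  refine sup_le (sup_le (hff.trans le_sup_left) ?_) (sup_le ?_ ?_)
  · refine le_trans ?_ le_sup_right
    rw [mul_left_comm]
    exact Ideal.mul_mono_right ((Ideal.mul_mono hfa le_rfl).trans hxx)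
  · refine le_trans ?_ le_sup_right
    rw [mul_assoc]
    exact Ideal.mul_mono_right ((Ideal.mul_mono le_rfl hfb).trans hxx)
  · refine le_trans ?_ le_sup_right
    calc 𝔪 * weightedMonomialIdeal x w a * (𝔪 * weightedMonomialIdeal x w b)
        = 𝔪 * (𝔪 * (weightedMonomialIdeal x w a * weightedMonomialIdeal x w b)) := by ring
      _ ≤ 𝔪 * (weightedMonomialIdeal x w a * weightedMonomialIdeal x w b) :=
          Ideal.mul_mono_right Ideal.mul_le_left
      _ ≤ 𝔪 * weightedMonomialIdeal x w (a + b) := Ideal.mul_mono_right hxx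

/-- **If `fᵢ ∈ 𝒥_{wᵢ}(x)` and `xᵢ ∈ 𝒥_{wᵢ}(f) + 𝔪·𝒥_{wᵢ}(x)` for all `i`, then
`𝒥ₙ(x) ⊆ 𝒥ₙ(f) + 𝔪·𝒥ₙ(x)` for all `n`.** [folklore] -/
theorem weightedMonomialIdeal_le_sup_mul_of_forall_mem_sup (𝔪 : Ideal A)
    (hf : ∀ i, f i ∈ weightedMonomialIdeal x w (w i))
    (hx : ∀ i, x i ∈ weightedMonomialIdeal f w (w i) ⊔ 𝔪 * weightedMonomialIdeal x w (w i)) (n : ℕ) :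
    weightedMonomialIdeal x w n ≤ weightedMonomialIdeal f w n ⊔ 𝔪 * weightedMonomialIdeal x w n := by
  refine weightedMonomialIdeal_le_of_forall_mem_of_mul_le
    (fun a => weightedMonomialIdeal f w a ⊔ 𝔪 * weightedMonomialIdeal x w a) ?_
    (sup_mul_weightedMonomialIdeal_mul_le x f w 𝔪 hf) ?_ x w hx n
  · rw [weightedMonomialIdeal_zero, top_sup_eq]
  · intro a b hab
    exact sup_le_sup (weightedMonomialIdeal_antitone f w hab)
      (Ideal.mul_mono_right (weightedMonomialIdeal_antitone x w hab))

/-- **Nakayama form of the comparison.**  In a Noetherian ring, with `𝔪` inside the Jacobson radical (e.g. the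
maximal ideal of a local ring): if `fᵢ ∈ 𝒥_{wᵢ}(x)` and `xᵢ ∈ 𝒥_{wᵢ}(f) + 𝔪·𝒥_{wᵢ}(x)` for all `i`, then
`𝒥ₙ(f) = 𝒥ₙ(x)` for all `n`. [folklore] -/
theorem weightedMonomialIdeal_eq_of_forall_mem_sup [IsNoetherianRing A] (𝔪 : Ideal A)
    (h𝔪 : 𝔪 ≤ Ideal.jacobson ⊥)
    (hf : ∀ i, f i ∈ weightedMonomialIdeal x w (w i))
    (hx : ∀ i, x i ∈ weightedMonomialIdeal f w (w i) ⊔ 𝔪 * weightedMonomialIdeal x w (w i)) (n : ℕ) :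
    weightedMonomialIdeal f w n = weightedMonomialIdeal x w n := by
  refine le_antisymm (weightedMonomialIdeal_le_of_forall_mem x f w hf n) ?_
  exact Submodule.le_of_le_smul_of_le_jacobson_bot (IsNoetherian.noetherian _) h𝔪
    (weightedMonomialIdeal_le_sup_mul_of_forall_mem_sup x f w 𝔪 hf hx n)

/-! ## The height-two criterion -/

/-- With two parameters and `w₁ ≤ w₀`, the piece `𝒥_{w₀}(x)` lies in `(x₀) + (x₁^e : e·w₁ ≥ w₀)`. [folklore] -/
theorem weightedMonomialIdeal_two_le_sup (x : Fin 2 → A) (w : Fin 2 → ℕ) :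
    weightedMonomialIdeal x w (w 0) ≤
      Ideal.span {x 0} ⊔ Ideal.span {r | ∃ e : ℕ, w 0 ≤ w 1 * e ∧ r = x 1 ^ e} := by
  rw [weightedMonomialIdeal, Ideal.span_le]
  rintro _ ⟨α, hα, rfl⟩
  rw [Fin.prod_univ_two]
  rcases Nat.eq_zero_or_pos (α 0) with h0 | h0
  · -- `α₀ = 0`: the monomial is `x₁^{α₁}` with `w₁ α₁ ≥ w₀`
    refine Ideal.mem_sup_right (Ideal.subset_span ⟨α 1, ?_, ?_⟩)
    · rw [Fin.sum_univ_two, h0, mul_zero, zero_add] at hα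
      exact hα
    · rw [h0, pow_zero, one_mul]
  · -- `α₀ ≥ 1`: divisible by `x₀`
    refine Ideal.mem_sup_left (Ideal.mem_span_singleton.mpr ?_)
    exact Dvd.dvd.mul_right (dvd_pow_self _ (Nat.pos_iff_ne_zero.mp h0)) _

/-- **The height-two criterion.**  In a local ring `A` let `x = (x₀, x₁)` and `f = (f₀, f₁)` both generate `𝔪`,
let the weights satisfy `0 < w₁ ≤ w₀`, and assume `f₀ ∈ 𝒥_{w₀}(x)` and `f₀ ∉ 𝔪²`.  Then the weighted filtrations
agree: `𝒥ₙ(f; w) = 𝒥ₙ(x; w)` for all `n`.  (Re-choosing the first parameter of the Abramovich–Quek–Schober germ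
inside its own piece, keeping it of order one, and the second parameter arbitrarily, does not change the centre.)
[folklore] -/
theorem weightedMonomialIdeal_eq_of_height_two [IsLocalRing A] (x f : Fin 2 → A) (w : Fin 2 → ℕ)
    (hw1 : 0 < w 1) (hw : w 1 ≤ w 0)
    (hx : Ideal.span (Set.range x) = IsLocalRing.maximalIdeal A)
    (hfm : Ideal.span (Set.range f) = IsLocalRing.maximalIdeal A)
    (hf0 : f 0 ∈ weightedMonomialIdeal x w (w 0)) (hf0' : f 0 ∉ IsLocalRing.maximalIdeal A ^ 2) (n : ℕ) :
    weightedMonomialIdeal f w n = weightedMonomialIdeal x w n := by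
  have hwpos : ∀ i, 0 < w i := fun i => by fin_cases i <;> [exact hw1.trans_le hw; exact hw1]
  have hxm : ∀ i, x i ∈ IsLocalRing.maximalIdeal A := fun i => hx ▸ Ideal.subset_span ⟨i, rfl⟩
  have hfmem : ∀ i, f i ∈ IsLocalRing.maximalIdeal A := fun i => hfm ▸ Ideal.subset_span ⟨i, rfl⟩
  -- `𝔪 ⊆ 𝒥_{w₁}(x)` and `𝔪 ⊆ 𝒥_{w₁}(f)` (both parameters have weight `≥ w₁`)
  have hm_le : ∀ (y : Fin 2 → A), Ideal.span (Set.range y) = IsLocalRing.maximalIdeal A →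
      IsLocalRing.maximalIdeal A ≤ weightedMonomialIdeal y w (w 1) := by
    intro y hy
    rw [← hy, Ideal.span_le]
    rintro _ ⟨i, rfl⟩
    refine weightedMonomialIdeal_antitone y w ?_ (self_mem_weightedMonomialIdeal y w i)
    fin_cases i <;> [exact hw; exact le_rfl]
  -- one inclusion: `fᵢ ∈ 𝒥_{wᵢ}(x)`
  have hf : ∀ i, f i ∈ weightedMonomialIdeal x w (w i) := fun i => by
    fin_cases i
    · exact hf0
    · exact hm_le x hx (hfmem 1)
  -- `x₁^e ∈ 𝒥_{w₀}(f)` whenever `e w₁ ≥ w₀`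
  have hpow : ∀ e : ℕ, w 0 ≤ w 1 * e → x 1 ^ e ∈ weightedMonomialIdeal f w (w 0) := fun e he =>
    weightedMonomialIdeal_antitone f w he (pow_mem_weightedMonomialIdeal f w (hm_le f hfm (hxm 1)) e)
  -- the other inclusion: `xᵢ ∈ 𝒥_{wᵢ}(f)`
  have hxf : ∀ i, x i ∈ weightedMonomialIdeal f w (w i) := by
    intro i
    fin_cases i
    · -- `x₀`
      show x 0 ∈ weightedMonomialIdeal f w (w 0)
      rcases hw.eq_or_lt with heq | hlt
      · rw [← heq]; exact hm_le f hfm (hxm 0)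
      · -- `f₀ = a x₀ + r`
        obtain ⟨a', ha', r, hr, hsum⟩ := Submodule.mem_sup.mp (weightedMonomialIdeal_two_le_sup x w hf0)
        obtain ⟨a, rfl⟩ := Ideal.mem_span_singleton'.mp ha'
        -- `r ∈ 𝒥_{w₀}(f)` and `r ∈ 𝔪²`
        have hrf : r ∈ weightedMonomialIdeal f w (w 0) := by
          revert hr; refine fun hr => Ideal.span_le.mpr ?_ hr
          rintro _ ⟨e, he, rfl⟩
          exact hpow e he
        have hr2 : r ∈ IsLocalRing.maximalIdeal A ^ 2 := by
          revert hr; refine fun hr => Ideal.span_le.mpr ?_ hr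
          rintro _ ⟨e, he, rfl⟩
          have he2 : 2 ≤ e := by
            by_contra h
            push Not at h
            interval_cases e
            · simp at he; omega
            · rw [mul_one] at he; omega
          exact Ideal.pow_le_pow_right he2 (Ideal.pow_mem_pow (hxm 1) e)
        -- `a` is a unit
        have ha : IsUnit a := by
          by_contra hna
          apply hf0'
          rw [← hsum]
          refine Ideal.add_mem _ ?_ hr2
          rw [pow_two]
          exact Ideal.mul_mem_mul ((IsLocalRing.mem_maximalIdeal a).mpr hna) (hxm 0)
        obtain ⟨b, hb⟩ := ha.exists_left_inv
        have hx0 : x 0 = b * (a * x 0 + r) - b * r := by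
          rw [mul_add, add_sub_cancel_right, ← mul_assoc, hb, one_mul]
        rw [hx0, hsum]
        exact Ideal.sub_mem _ (Ideal.mul_mem_left _ _ (self_mem_weightedMonomialIdeal f w 0))
          (Ideal.mul_mem_left _ _ hrf)
    · exact hm_le f hfm (hxm 1)
  exact le_antisymm (weightedMonomialIdeal_le_of_forall_mem x f w hf n)
    (weightedMonomialIdeal_le_of_forall_mem f x w hxf n)

end Summit.ResolutionOfSingularities.ResolutionOfSingularities.Theorems

end
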